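import Literature.NumberTheory.Automorphic.IwasawaCoordinatesAdelic
import Literature.NumberTheory.Automorphic.AdelicVectorHeightCompact
import Literature.NumberTheory.Automorphic.MirabolicTowerInvariance
import Literature.NumberTheory.Automorphic.RankinSelbergTorusIntegral
import HarnessLib

/-!
# Iwasawa data of the corner torus points `diag(a k, 1) ∈ GL_{m+1}(𝔸_K)`
(Cogdell (2004), §2.3 / Jacquet–Piatetski-Shapiro–Shalika (1983), §2: the torus points of the unfolded
`GL_{m+1} × GL_m` integral and their archimedean and finite Iwasawa coordinates)

Topic `NumberTheory/Automorphic`; namespace `Literature.NumberTheory.Automorphic`. Proof file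
(theorems only). For the gauge estimates of the Whittaker function of a cusp form on `GL_{m+1}` at the
points `g = diag(diag(a) k, 1)` (`a ∈ (𝔸_Kˣ)ᵐ`, `k ∈ K_m = K_∞ GL_m(𝒪̂)`; `torusPoint`, `glCorner`) one
needs these points in the format of the tree's support and decay theorems
(`valued_lt_of_whittakerDepth_zero_ne_zero`: finite part `diag(t) k_f`, `k_f ∈ GL_n(𝒪̂)`;
`IsCuspFormGL.exists_norm_whittakerDepth_zero_mul_pow_le`: archimedean part `diag(d) κ`, `κ ∈ K_∞`,
`d` real positive at the place `w`). This file provides: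

* `glCorner_map` — `diag(·,1)` commutes with entrywise ring homomorphisms; hence
  `GLn.sndHom_glCorner`, `GLn.fstHom_glCorner`, `GLn.toMixed_glCorner`;
* `GLn.sndHom_glDiagonal`, `GLn.toMixed_glDiagonal` — components of diagonal torus elements;
* `glCorner_mem_glFiniteIntegralLevel` — `diag(k,1) ∈ GL_{m+1}(𝒪̂)` for `k ∈ GL_m(𝒪̂)`;
* `glCorner_mem_Kinf` — `diag(κ,1) ∈ K_∞^{(m+1)}` for `κ ∈ K_∞^{(m)}`;
* `glDiagonal_mem_Kinf_of_norm_eq_one` — a diagonal matrix with entries of modulus one at every place is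
  in `K_∞`; `norm_mixedSpaceEvalAt_archUnit` — `‖eval_w(x_∞)‖ = ‖x_w‖`;
* `sndHom_glCorner_torusPoint` (**finite Iwasawa data**) —
  `(diag(diag(a) k, 1))_f = diag(Fin.snoc a_f 1) · diag(k_f, 1)` with `diag(k_f,1) ∈ GL_{m+1}(𝒪̂)`;
* `exists_toMixed_glCorner_torusPoint` (**archimedean Iwasawa data**) —
  `(diag(diag(a) k, 1))_∞ = diag(d) κ` with `κ ∈ K_∞`, `d_i` the positive unit of sizes
  `‖a_{i,w}‖` (`i < m`) and `d_m = 1`, in the format of the decay theorem.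

## References

* J. W. Cogdell, *Analytic theory of L-functions for GL_n* (2004), §2.3 [CogdellAnalyticTheory2004].
* H. Jacquet, I. I. Piatetski-Shapiro, J. Shalika, *Rankin–Selberg convolutions*, Amer. J. Math.
  105 (1983), §2.
-/

noncomputable section

open MeasureTheory NumberField NumberField.InfinitePlace NumberField.mixedEmbedding IsDedekindDomain Matrix
open Literature.NumberTheory.GaloisRepresentations (ideleGroup)
open scoped MatrixGroups

namespace Literature.NumberTheory.Automorphic

/-! ### The corner embedding commutes with entrywise maps -/

section CornerMap

variable {m n : ℕ} {R S : Type*} [CommRing R] [CommRing S]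

/-- **`diag(·, 1)` commutes with entrywise ring homomorphisms.** [folklore] -/
theorem glCorner_map (f : R →+* S) (h : m ≤ n) (g : GL (Fin m) R) :
    Matrix.GeneralLinearGroup.map f (glCorner R h g) = glCorner S h (Matrix.GeneralLinearGroup.map f g) := by
  refine Matrix.GeneralLinearGroup.ext fun i j => ?_
  change f (((glCorner R h g : GL (Fin n) R) : Matrix (Fin n) (Fin n) R) i j) = _
  rw [glCorner_apply_val, glCorner_apply_val]
  by_cases hi : (i : ℕ) < m <;> by_cases hj : (j : ℕ) < m
  · rw [dif_pos hi, dif_pos hj, dif_pos hi, dif_pos hj]; rfl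
  · rw [dif_pos hi, dif_neg hj, dif_pos hi, dif_neg hj, map_zero]
  · rw [dif_neg hi, if_pos hj, dif_neg hi, if_pos hj, map_zero]
  · rw [dif_neg hi, if_neg hj, dif_neg hi, if_neg hj]
    split_ifs
    · exact map_one f
    · exact map_zero f

end CornerMap

section Adelic

variable {m n : ℕ} {K : Type} [Field K] [NumberField K]

/-- The finite part of `diag(g, 1)` is `diag(g_f, 1)`. [folklore] -/
theorem GLn.sndHom_glCorner (h : m ≤ n) (g : GL (Fin m) (AdeleRing (𝓞 K) K)) :
    GLn.sndHom n K (glCorner (AdeleRing (𝓞 K) K) h g) =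
      glCorner (FiniteAdeleRing (𝓞 K) K) h (GLn.sndHom m K g) :=
  glCorner_map _ h g

/-- The archimedean part of `diag(g, 1)` is `diag(g_∞, 1)`. [folklore] -/
theorem GLn.fstHom_glCorner (h : m ≤ n) (g : GL (Fin m) (AdeleRing (𝓞 K) K)) :
    GLn.fstHom n K (glCorner (AdeleRing (𝓞 K) K) h g) =
      glCorner (InfiniteAdeleRing K) h (GLn.fstHom m K g) :=
  glCorner_map _ h g

omit [NumberField K] in
/-- `GLn.infiniteEquivMixed` is the entrywise map of `ringEquiv_mixedSpace`. [folklore] -/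
theorem GLn.infiniteEquivMixed_eq_map (g : GL (Fin n) (InfiniteAdeleRing K)) :
    GLn.infiniteEquivMixed n K g =
      Matrix.GeneralLinearGroup.map (InfiniteAdeleRing.ringEquiv_mixedSpace K).toRingHom g :=
  Matrix.GeneralLinearGroup.ext fun _ _ => rfl

/-- The mixed archimedean part of `diag(g, 1)` is `diag(g_∞, 1)`. [folklore] -/
theorem GLn.toMixed_glCorner (h : m ≤ n) (g : GL (Fin m) (AdeleRing (𝓞 K) K)) :
    GLn.toMixed n K (glCorner (AdeleRing (𝓞 K) K) h g) = glCorner (mixedSpace K) h (GLn.toMixed m K g) := by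
  rw [GLn.toMixed_apply, GLn.toMixed_apply, GLn.fstHom_glCorner, GLn.infiniteEquivMixed_eq_map,
    GLn.infiniteEquivMixed_eq_map, glCorner_map]

/-- Entrywise maps of diagonal matrices. [folklore] -/
theorem generalLinearGroup_map_glDiagonal {R S : Type*} [CommRing R] [CommRing S] (f : R →+* S) (d : Fin n → Rˣ) :
    Matrix.GeneralLinearGroup.map f (glDiagonal n R d) = glDiagonal n S fun i => Units.map f.toMonoidHom (d i) := by
  refine Matrix.GeneralLinearGroup.ext fun i j => ?_
  change f ((glDiagonal n R d : Matrix (Fin n) (Fin n) R) i j) = _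
  rw [coe_glDiagonal, coe_glDiagonal, Matrix.diagonal_apply, Matrix.diagonal_apply]
  split_ifs
  · rfl
  · exact map_zero f

/-- The finite part of `diag(a)` is `diag(a_f)`. [folklore] -/
theorem GLn.sndHom_glDiagonal (a : Fin n → ideleGroup K) :
    GLn.sndHom n K (glDiagonal n (AdeleRing (𝓞 K) K) a) =
      glDiagonal n (FiniteAdeleRing (𝓞 K) K) fun i =>
        Units.map (RingHom.snd (InfiniteAdeleRing K) (FiniteAdeleRing (𝓞 K) K)).toMonoidHom (a i) :=
  generalLinearGroup_map_glDiagonal _ a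

/-- The mixed archimedean part of `diag(a)` is `diag(a_∞)`. [folklore] -/
theorem GLn.toMixed_glDiagonal (a : Fin n → ideleGroup K) :
    GLn.toMixed n K (glDiagonal n (AdeleRing (𝓞 K) K) a) =
      glDiagonal n (mixedSpace K) fun i =>
        Units.map (InfiniteAdeleRing.ringEquiv_mixedSpace K).toRingHom.toMonoidHom
          (Units.map (RingHom.fst (InfiniteAdeleRing K) (FiniteAdeleRing (𝓞 K) K)).toMonoidHom (a i)) := by
  rw [GLn.toMixed_apply, GLn.infiniteEquivMixed_eq_map]
  change Matrix.GeneralLinearGroup.map _ (Matrix.GeneralLinearGroup.map _ (glDiagonal n (AdeleRing (𝓞 K) K) a)) = _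
  rw [generalLinearGroup_map_glDiagonal, generalLinearGroup_map_glDiagonal]
  rfl

/-! ### Corners of the maximal compact subgroups -/

/-- **`diag(k, 1) ∈ GL_n(𝒪̂)` for `k ∈ GL_m(𝒪̂)`.** [folklore] -/
theorem glCorner_mem_glFiniteIntegralLevel (h : m ≤ n) {k : GL (Fin m) (FiniteAdeleRing (𝓞 K) K)}
    (hk : k ∈ glFiniteIntegralLevel m K) :
    glCorner (FiniteAdeleRing (𝓞 K) K) h k ∈ glFiniteIntegralLevel n K := by
  rw [mem_glFiniteIntegralLevel_iff] at hk ⊢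
  have hentry : ∀ (g : GL (Fin m) (FiniteAdeleRing (𝓞 K) K)),
      (∀ i j, (g : Matrix (Fin m) (Fin m) (FiniteAdeleRing (𝓞 K) K)) i j ∈ integralFiniteAdeles K) →
      ∀ i j, ((glCorner (FiniteAdeleRing (𝓞 K) K) h g : GL (Fin n) (FiniteAdeleRing (𝓞 K) K)) :
        Matrix (Fin n) (Fin n) (FiniteAdeleRing (𝓞 K) K)) i j ∈ integralFiniteAdeles K := by
    intro g hg i j
    rw [glCorner_apply_val]
    by_cases hi : (i : ℕ) < m <;> by_cases hj : (j : ℕ) < m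
    · rw [dif_pos hi, dif_pos hj]; exact hg _ _
    · rw [dif_pos hi, dif_neg hj]; exact zero_mem _
    · rw [dif_neg hi, if_pos hj]; exact zero_mem _
    · rw [dif_neg hi, if_neg hj]
      split_ifs
      · exact one_mem _
      · exact zero_mem _
  refine ⟨hentry k hk.1, fun i j => ?_⟩
  rw [← map_inv]
  exact hentry k⁻¹ hk.2 i j

/-- **`diag(κ, 1) ∈ K_∞^{(n)}` for `κ ∈ K_∞^{(m)}`** (the corner of a unitary matrix is unitary at every
place). [folklore] -/
theorem glCorner_mem_Kinf (h : m ≤ n) {κ : GL (Fin m) (mixedSpace K)} (hκ : κ ∈ Kinf m K) :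
    glCorner (mixedSpace K) h κ ∈ Kinf n K := by
  rw [mem_Kinf_iff] at hκ ⊢
  -- the corner of a unitary matrix is unitary, over `ℝ` and over `ℂ`
  have key : ∀ {F : Type} [RCLike F] (u : GL (Fin m) F), u ∈ unitarySubgroupGL F (Fin m) →
      glCorner F h u ∈ unitarySubgroupGL F (Fin n) := by
    intro F _ u hu
    rw [mem_unitarySubgroupGL_iff_coe_mem_unitaryGroup] at hu ⊢
    rw [Matrix.mem_unitaryGroup_iff] at hu ⊢
    -- `diag(u,1) diag(u,1)* = diag(u u*, 1) = 1`
    have hstar : star ((glCorner F h u : GL (Fin n) F) : Matrix (Fin n) (Fin n) F) =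
        ((glCorner F h (⟨star (u : Matrix (Fin m) (Fin m) F), (u : Matrix (Fin m) (Fin m) F), ?_, ?_⟩ : GL (Fin m) F) :
          GL (Fin n) F) : Matrix (Fin n) (Fin n) F) := ?_
    rotate_left
    · -- star u * u = 1
      exact Matrix.mem_unitaryGroup_iff'.1 (Matrix.mem_unitaryGroup_iff.2 hu)
    · exact hu
    · ext i j
      rw [Matrix.star_apply, glCorner_apply_val, glCorner_apply_val]
      by_cases hi : (i : ℕ) < m <;> by_cases hj : (j : ℕ) < m
      · rw [dif_pos hj, dif_pos hi, dif_pos hi, dif_pos hj]; rfl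
      · rw [dif_pos hi, dif_neg hj, dif_neg hj, if_pos hi, star_zero]
      · rw [dif_neg hi, if_pos hj, dif_pos hj, dif_neg hi, star_zero]
      · rw [dif_neg hi, if_neg hj, dif_neg hj, if_neg hi]
        by_cases hij : i = j
        · subst hij; simp
        · rw [if_neg hij, if_neg (Ne.symm hij), star_zero]
    rw [hstar, ← Units.val_mul, ← map_mul]
    have h1 : u * (⟨star (u : Matrix (Fin m) (Fin m) F), (u : Matrix (Fin m) (Fin m) F),
        Matrix.mem_unitaryGroup_iff'.1 (Matrix.mem_unitaryGroup_iff.2 hu), hu⟩ : GL (Fin m) F) = 1 :=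
      Units.ext hu
    rw [h1, map_one, Units.val_one]
  refine ⟨fun w => ?_, fun w => ?_⟩
  · rw [glCorner_map]; exact key _ (hκ.1 w)
  · rw [glCorner_map]; exact key _ (hκ.2 w)

/-! ### Corners of diagonal matrices -/

/-- **`diag(diag(d), 1) = diag(snoc d 1)`.** [folklore] -/
theorem glCorner_glDiagonal_eq_glDiagonal_snoc {R : Type*} [CommRing R] (d : Fin m → Rˣ) :
    glCorner R (Nat.le_succ m) (glDiagonal m R d) = glDiagonal (m + 1) R (Fin.snoc d 1) := by
  refine Matrix.GeneralLinearGroup.ext fun i j => ?_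
  rw [glCorner_apply_val, coe_glDiagonal, coe_glDiagonal, Matrix.diagonal_apply]
  by_cases hi : (i : ℕ) < m <;> by_cases hj : (j : ℕ) < m
  · rw [dif_pos hi, dif_pos hj, Matrix.diagonal_apply]
    have hi' : i = Fin.castSucc ⟨i, hi⟩ := Fin.ext rfl
    by_cases hij : i = j
    · subst hij
      rw [if_pos rfl, if_pos rfl]
      conv_rhs => rw [hi', Fin.snoc_castSucc]
    · have hij' : (⟨i, hi⟩ : Fin m) ≠ ⟨j, hj⟩ := fun h => hij (Fin.ext (Fin.mk.inj_iff.mp h))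
      rw [if_neg hij', if_neg hij]
  · rw [dif_pos hi, dif_neg hj]
    have hij : i ≠ j := fun h => hj (h ▸ hi)
    rw [if_neg hij]
  · rw [dif_neg hi, if_pos hj]
    have hij : i ≠ j := fun h => hi (h ▸ hj)
    rw [if_neg hij]
  · rw [dif_neg hi, if_neg hj]
    have hi' : i = Fin.last m := Fin.ext (by have := i.2; simp only [Fin.val_last]; omega)
    by_cases hij : i = j
    · subst hij
      rw [if_pos rfl, if_pos rfl, hi', Fin.snoc_last, Units.val_one]
    · rw [if_neg hij, if_neg hij]

/-! ### Diagonal phases lie in `K_∞` -/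

/-- **A diagonal matrix whose entries have modulus one at every infinite place lies in `K_∞`.**
[folklore] -/
theorem glDiagonal_mem_Kinf_of_norm_eq_one {d : Fin n → (mixedSpace K)ˣ}
    (hd : ∀ (i : Fin n) (w : InfinitePlace K), ‖mixedSpaceEvalAt K w (d i : mixedSpace K)‖ = 1) :
    glDiagonal n (mixedSpace K) d ∈ Kinf n K := by
  -- a diagonal matrix with unit-modulus entries is unitary
  have key : ∀ {F : Type} [RCLike F] (e : Fin n → Fˣ), (∀ i, ‖(e i : F)‖ = 1) →
      glDiagonal n F e ∈ unitarySubgroupGL F (Fin n) := by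
    intro F _ e he
    rw [mem_unitarySubgroupGL_iff_coe_mem_unitaryGroup, Matrix.mem_unitaryGroup_iff, coe_glDiagonal,
      Matrix.star_eq_conjTranspose, Matrix.diagonal_conjTranspose, Matrix.diagonal_mul_diagonal,
      ← Matrix.diagonal_one]
    congr 1
    funext i
    rw [Pi.star_apply, RCLike.star_def, RCLike.mul_conj, he i]
    simp
  rw [mem_Kinf_iff]
  refine ⟨fun w => ?_, fun w => ?_⟩
  · rw [generalLinearGroup_map_glDiagonal]
    refine key _ fun i => ?_
    have h := hd i w.1
    rw [mixedSpaceEvalAt_of_isReal w.2] at h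
    rw [Complex.norm_real] at h
    exact h
  · rw [generalLinearGroup_map_glDiagonal]
    refine key _ fun i => ?_
    have h := hd i w.1
    rw [mixedSpaceEvalAt_of_isComplex w.2] at h
    exact h

/-! ### The archimedean units of an idele and their radii -/

/-- **The modulus at `w` of the mixed-space image of an idele is the norm of its `w`-component**:
`‖eval_w (x_∞)‖ = ‖x_w‖`. [folklore] -/
theorem norm_mixedSpaceEvalAt_archUnit (x : ideleGroup K) (w : InfinitePlace K) :
    ‖mixedSpaceEvalAt K w ((Units.map (InfiniteAdeleRing.ringEquiv_mixedSpace K).toRingHom.toMonoidHom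
        (Units.map (RingHom.fst (InfiniteAdeleRing K) (FiniteAdeleRing (𝓞 K) K)).toMonoidHom x) : (mixedSpace K)ˣ) :
          mixedSpace K)‖ = ‖((x : ideleGroup K) : AdeleRing (𝓞 K) K).1 w‖ := by
  set y : InfiniteAdeleRing K := ((x : ideleGroup K) : AdeleRing (𝓞 K) K).1 with hy
  have hval : ((Units.map (InfiniteAdeleRing.ringEquiv_mixedSpace K).toRingHom.toMonoidHom
      (Units.map (RingHom.fst (InfiniteAdeleRing K) (FiniteAdeleRing (𝓞 K) K)).toMonoidHom x) : (mixedSpace K)ˣ) : mixedSpace K) =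
      InfiniteAdeleRing.ringEquiv_mixedSpace K y := rfl
  rw [hval]
  have hiso := (Completion.isometry_extensionEmbedding w).norm_map_of_map_zero (map_zero _) (y w)
  rcases isReal_or_isComplex w with hw | hw
  · -- the complex coordinate at a real place read through `ringEquiv_mixedSpace` (as in `ArchExpIdeleGLOne`)
    have h1 : Completion.extensionEmbedding w (y w) =
        ((InfiniteAdeleRing.ringEquiv_mixedSpace K y).1 ⟨w, hw⟩ : ℂ) := by
      rw [InfiniteAdeleRing.ringEquiv_mixedSpace_apply]
      exact (Completion.extensionEmbeddingOfIsReal_apply hw _).symm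
    rw [mixedSpaceEvalAt_of_isReal hw, ← h1, hiso]
  · have h2 : Completion.extensionEmbedding w (y w) = (InfiniteAdeleRing.ringEquiv_mixedSpace K y).2 ⟨w, hw⟩ := rfl
    rw [mixedSpaceEvalAt_of_isComplex hw, ← h2, hiso]

omit [NumberField K] in
/-- `eval_w` of a unit of the mixed space is non-zero. [folklore] -/
theorem mixedSpaceEvalAt_unit_ne_zero (z : (mixedSpace K)ˣ) (w : InfinitePlace K) :
    mixedSpaceEvalAt K w (z : mixedSpace K) ≠ 0 :=
  (Units.map (mixedSpaceEvalAt K w : mixedSpace K →* ℂ) z).ne_zero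

/-! ### The archimedean Iwasawa data of a corner torus point -/

/-- **Archimedean Iwasawa data of `diag(diag(a) k, 1)`.** For `a ∈ (𝔸_Kˣ)ᵐ` and `k` in the standard
maximal compact subgroup of `GL_m(𝔸_K)` there are `dd` and `κ ∈ K_∞^{(m+1)}` with
`(diag(diag(a) k, 1))_∞ = diag(dd) κ`, where `eval_w (dd_i) = ‖a_{i,w}‖` for `i < m` and
`eval_w (dd_m) = 1`, at every infinite place `w` (polar decomposition of the archimedean components of
the `a_i`; the phases and `k_∞` go into `κ`). [folklore] -/
theorem exists_toMixed_glCorner_torusPoint (a : Fin m → ideleGroup K)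
    {k : GL (Fin m) (AdeleRing (𝓞 K) K)} (hk : k ∈ standardMaximalCompactGL m K) :
    ∃ (dd : Fin (m + 1) → (mixedSpace K)ˣ) (κ : GL (Fin (m + 1)) (mixedSpace K)), κ ∈ Kinf (m + 1) K ∧
      GLn.toMixed (m + 1) K (glCorner (AdeleRing (𝓞 K) K) (Nat.le_succ m) (glDiagonal m (AdeleRing (𝓞 K) K) a * k)) =
        glDiagonal (m + 1) (mixedSpace K) dd * κ ∧
      ∀ w : InfinitePlace K,
        (∀ i : Fin m, mixedSpaceEvalAt K w (dd (Fin.castSucc i) : mixedSpace K) =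
          ((‖((a i : ideleGroup K) : AdeleRing (𝓞 K) K).1 w‖ : ℝ) : ℂ)) ∧
        mixedSpaceEvalAt K w (dd (Fin.last m) : mixedSpace K) = 1 := by
  -- the archimedean units of the `a i` and their radii
  set z : Fin m → (mixedSpace K)ˣ := fun i =>
    Units.map (InfiniteAdeleRing.ringEquiv_mixedSpace K).toRingHom.toMonoidHom
      (Units.map (RingHom.fst (InfiniteAdeleRing K) (FiniteAdeleRing (𝓞 K) K)).toMonoidHom (a i)) with hz
  set ρ : Fin m → InfinitePlace K → ℝ := fun i w => ‖((a i : ideleGroup K) : AdeleRing (𝓞 K) K).1 w‖ with hρ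
  have hzn : ∀ i w, ‖mixedSpaceEvalAt K w (z i : mixedSpace K)‖ = ρ i w :=
    fun i w => norm_mixedSpaceEvalAt_archUnit (a i) w
  have hρpos : ∀ i w, 0 < ρ i w := fun i w => by
    rw [← hzn i w]
    exact norm_pos_iff.2 (mixedSpaceEvalAt_unit_ne_zero (z i) w)
  set r : Fin m → (mixedSpace K)ˣ := fun i => mixedPosUnit K (ρ i) (hρpos i) with hr
  set p : Fin m → (mixedSpace K)ˣ := fun i => z i * (r i)⁻¹ with hp
  have hzrp : z = r * p := by
    funext i; simp only [Pi.mul_apply, hp]; rw [mul_comm (r i), inv_mul_cancel_right]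
  -- the phases have modulus one at every place
  have hrinv : ∀ i w, mixedSpaceEvalAt K w (((r i)⁻¹ : (mixedSpace K)ˣ) : mixedSpace K) = (((ρ i w : ℝ) : ℂ))⁻¹ := by
    intro i w
    have h1 : mixedSpaceEvalAt K w ((r i : (mixedSpace K)ˣ) : mixedSpace K) *
        mixedSpaceEvalAt K w (((r i)⁻¹ : (mixedSpace K)ˣ) : mixedSpace K) = 1 := by
      rw [← map_mul, Units.mul_inv, map_one]
    rw [hr, mixedSpaceEvalAt_mixedPosUnit] at h1
    exact (eq_inv_of_mul_eq_one_right h1)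
  have hpnorm : ∀ i w, ‖mixedSpaceEvalAt K w (p i : mixedSpace K)‖ = 1 := by
    intro i w
    simp only [hp, Units.val_mul, map_mul, norm_mul]
    rw [hzn i w, hrinv i w, norm_inv, Complex.norm_real, Real.norm_of_nonneg (hρpos i w).le,
      mul_inv_cancel₀ (hρpos i w).ne']
  -- the decomposition
  set κ : GL (Fin (m + 1)) (mixedSpace K) :=
    glCorner (mixedSpace K) (Nat.le_succ m) (glDiagonal m (mixedSpace K) p * GLn.toMixed m K k) with hκ
  have hκK : κ ∈ Kinf (m + 1) K :=
    glCorner_mem_Kinf (Nat.le_succ m) ((Kinf m K).mul_mem (glDiagonal_mem_Kinf_of_norm_eq_one hpnorm)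
      (toMixed_mem_Kinf_of_mem_standardMaximalCompactGL hk))
  refine ⟨Fin.snoc r 1, κ, hκK, ?_, fun w => ⟨fun i => ?_, ?_⟩⟩
  · have hzdiag : GLn.toMixed m K (glDiagonal m (AdeleRing (𝓞 K) K) a) = glDiagonal m (mixedSpace K) z :=
      GLn.toMixed_glDiagonal a
    rw [GLn.toMixed_glCorner, map_mul, hzdiag, hzrp, map_mul (glDiagonal m (mixedSpace K)), mul_assoc,
      map_mul (glCorner (mixedSpace K) (Nat.le_succ m)), glCorner_glDiagonal_eq_glDiagonal_snoc]
  · rw [Fin.snoc_castSucc, hr, mixedSpaceEvalAt_mixedPosUnit]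
  · rw [Fin.snoc_last, Units.val_one, map_one]

/-! ### The finite Iwasawa data of a corner torus point -/

/-- **Finite Iwasawa data of `diag(diag(a) k, 1)`**: its finite part is `diag(snoc a_f 1) · diag(k_f, 1)`
with `diag(k_f, 1) ∈ GL_{m+1}(𝒪̂)` for `k` in the standard maximal compact subgroup. [folklore] -/
theorem sndHom_glCorner_torusPoint (a : Fin m → ideleGroup K)
    {k : GL (Fin m) (AdeleRing (𝓞 K) K)} (hk : k ∈ standardMaximalCompactGL m K) :
    GLn.sndHom (m + 1) K (glCorner (AdeleRing (𝓞 K) K) (Nat.le_succ m) (glDiagonal m (AdeleRing (𝓞 K) K) a * k)) =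
      glDiagonal (m + 1) (FiniteAdeleRing (𝓞 K) K)
          (Fin.snoc (fun i => Units.map (RingHom.snd (InfiniteAdeleRing K) (FiniteAdeleRing (𝓞 K) K)).toMonoidHom (a i)) 1) *
        glCorner (FiniteAdeleRing (𝓞 K) K) (Nat.le_succ m) (GLn.sndHom m K k) ∧
      glCorner (FiniteAdeleRing (𝓞 K) K) (Nat.le_succ m) (GLn.sndHom m K k) ∈ glFiniteIntegralLevel (m + 1) K := by
  refine ⟨?_, glCorner_mem_glFiniteIntegralLevel (Nat.le_succ m) (sndHom_mem_of_mem_standardMaximalCompactGL hk)⟩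
  rw [GLn.sndHom_glCorner, map_mul, map_mul, GLn.sndHom_glDiagonal, glCorner_glDiagonal_eq_glDiagonal_snoc]

end Adelic

end Literature.NumberTheory.Automorphic
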